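import Literature.Geometry.Kaehler.ComplexTorusHodgeGroupProductLieKernels
import Literature.Geometry.Kaehler.ComplexTorusHodgeGroupProductLieAlgebraDecomposition
import Literature.Geometry.Kaehler.ComplexTorusHodgeGroupProductOneDimensionalFactor
import HarnessLib

/-!
# Moonen–Zarhin (3.1) with the summands IDENTIFIED: `Lie Hg(X₁ × X₂)(ℂ) ≅ 𝔤₁ × 𝔤₂ × 𝔤₃` with `𝔤₁ = Lie K₁`, `𝔤₂ = Lie K₂`
# (carriers), for tori with reductive `Lie Hg(Xᵢ)(ℂ)`; the graph case `K₁`, `K₂` finite; the one-dimensional-factor case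

Layer `Literature/Geometry/Kaehler`, namespace `Literature.Geometry.Kaehler.ComplexTorus`; lane `lit-hodgefound` (Track 2
foundations library), Layer A3/A4; prover seat `lit-hodgefound-p17` (generation 41, self-proposed row g41-#10): the junction of
`ComplexTorusHodgeGroupProductLieKernels` (g41-#5: the Goursat ideals of the block projections have carriers `Lie K₁`, `Lie K₂`;
`Kᵢ` finite ⟺ `rⱼ` is an isomorphism), `ComplexTorusHodgeGroupProductLieAlgebraDecomposition` (g41-#8: the three product
decompositions for reductive `Lie Hg(Xᵢ)(ℂ)`, ideals pinned by dimension only — its import could not yet see g41-#5) and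
`ComplexTorusHodgeGroupProductOneDimensionalFactor` (g41-#6: `dim Hg(X₂) = 1`: non-split ⟺ `K₂` finite).  THEOREMS ONLY (no
definition, no instance, no notation, no named fact; D-0026 net debt 0).

DICTIONARY.  `G = Hg(X₁ × X₂)(ℂ)`, `Gᵢ = Hg(Xᵢ)(ℂ)` in `GL` through `toGL`, `Lie = lieSubalgebraGL` (`= hodgeGroupComplexLie`),
`K₁ = hodgeGroupCProdInl = {s | (s 0; 0 1) ∈ G}`, `K₂ = hodgeGroupCProdInr`, `dim = zdim`.

## Sources, verbatim

* B. Moonen, Yu. G. Zarhin [MoonenZarhin1999LowDim], Math. Ann. 315 (1999), §3 (3.1), held `paper:arxiv-math_9901113` p0006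
  L25–L45: "there exist Lie algebras `𝔤₁`, `𝔤₂`, `𝔤₃` and an automorphism `φ` of `𝔤₃` such that `𝔥𝔤(X₁) ≅ 𝔤₁ ⊕ 𝔤₃`,
  `𝔥𝔤(X₂) ≅ 𝔤₂ ⊕ 𝔤₃`, and `𝔥𝔤(X₁ × X₂) ≅ 𝔤₁ ⊕ 𝔤₂ ⊕ Γ_φ`, where `Γ_φ ⊂ 𝔤₃ ⊕ 𝔤₃` is the graph of `φ`."; Lemma (3.6), proof
  (p0007 L22–L28): "we then have that `𝔥𝔤(X) = 𝔤₁ ⊕ 𝔤₃ ≅ 𝔥𝔤(X₁)` and `𝔥𝔤(X₂) ≅ 𝔤₃`."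
* B. B. Gordon [Gordon1997], *A survey of the Hodge conjecture for abelian varieties*, §2.16 Proposition (Goursat's Lemma), held
  `paper:arxiv-alg-geom_9709030` p0012 L112–L119: "Let `N` be the kernel of `p'` and let `N'` be the kernel of `p`. Then […] the
  image of `H` in `G/N × G'/N'` is the graph of an isomorphism `G/N ≃ G'/N'`."
* N. Bourbaki [Bourbaki1989LieGroups13], Ch. I §6 no. 4 Cor. (b) of Prop. 5 (p0112 L15–L19) (every ideal of a reductive Lie
  algebra is a direct factor); T. A. Springer [Springer1998], 4.4.5–4.4.7, 5.3.2, 1.8.2.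

## What is proved

* §1 **`exists_lieIdeal_carrier_lieEquiv_prod_prod_quotient`** — `Lie Hg(X₁)(ℂ)`, `Lie Hg(X₂)(ℂ)` reductive ⟹ ideals `N₁`, `N₂`
  WITH CARRIERS `Lie K₁`, `Lie K₂` such that `Lie Hg(X₁ × X₂)(ℂ) ≅ N₁ × N₂ × 𝔤₃`, `Lie Hg(X₁)(ℂ) ≅ N₁ × 𝔤₃`,
  `Lie Hg(X₂)(ℂ) ≅ N₂ × 𝔤₃`, `𝔤₃ = Lie Hg(X₁)(ℂ) ⧸ N₁ ≅ Lie Hg(X₂)(ℂ) ⧸ N₂`, with the four dimension identities;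
  **`IsRiemannForm.exists_lieIdeal_carrier_lieEquiv_hodgeGroupComplexLie_prod_prod_quotient`**, `IsAbelianVariety.…`.
* §2 THE GRAPH CASE (arbitrary tori): **`nonempty_lieEquiv_of_finite_of_finite`** (`K₁`, `K₂` finite ⟹
  `Lie Hg(X₁)(ℂ) ≅ Lie Hg(X₂)(ℂ)` — "`𝔥𝔤(X₁) ≅ 𝔤₃ ≅ 𝔥𝔤(X₂)`"), `nonempty_lieEquiv_hodgeGroupComplexLie_of_finite_of_finite`.
* §3 ONE-DIMENSIONAL FACTOR (arbitrary `X₁`, `dim Hg(X₂) = 1`, non-split): **`nonempty_lieEquiv_of_ne_of_zdim_eq_one`**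
  (`Lie Hg(X₁ × X₂)(ℂ) ≅ Lie Hg(X₁)(ℂ)`), `exists_surjective_lieHom_of_ne_of_zdim_eq_one` (`Lie Hg(X₁)(ℂ) ↠ Lie Hg(X₂)(ℂ)`),
  `nonempty_lieEquiv_hodgeGroupComplexLie_of_ne_of_zdim_eq_one`.

## References

* [MoonenZarhin1999LowDim] B. Moonen, Yu. G. Zarhin, Math. Ann. 315 (1999), §3 (3.1), Lemma (3.6).
* [Gordon1997] B. B. Gordon, *A survey of the Hodge conjecture for abelian varieties*, §2.16 Proposition.
* [Bourbaki1989LieGroups13] N. Bourbaki, *Lie Groups and Lie Algebras, Chapters 1–3*, Ch. I §6 no. 4.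
* [Springer1998] T. A. Springer, *Linear Algebraic Groups*, 2nd ed. (1998), 1.8.2, 4.4.5–4.4.7, 5.3.2.
-/

noncomputable section

open Matrix Module

namespace Literature.Geometry.Kaehler

namespace ComplexTorus

open Literature.NumberTheory.Automorphic (IsAlgebraicSubgroup IsZConnected identityComponent isZConnected_identityComponent
  lieAlgebraGL lieSubalgebraGL)
open Literature.Algebra.Lie

variable {ι₁ ι₂ : Type*} [Fintype ι₁] [Fintype ι₂] [DecidableEq ι₁] [DecidableEq ι₂]
  {E₁ E₂ : Type*} [NormedAddCommGroup E₁] [NormedSpace ℂ E₁] [NormedAddCommGroup E₂] [NormedSpace ℂ E₂]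
  (Φ₁ : (ι₁ → ℝ) ≃L[ℝ] E₁) (Φ₂ : (ι₂ → ℝ) ≃L[ℝ] E₂)

/-! ### §1 Moonen–Zarhin (3.1) with carriers -/

/-- The carriers of the Goursat ideals `𝔫₁ = r₁(ker r₂)`, `𝔫₂ = r₂(ker r₁)` of the block projections are `Lie K₁`, `Lie K₂`
(g41-#5 `mem_lieAlgebraGL_hodgeGroupCProdInl_iff_exists`), for ANY pair of block projections as produced by `exists_lieHom_toBlocks`. [folklore] -/
private theorem carriers_of_toBlocks
    (f : lieSubalgebraGL ((hodgeGroupC (prodPeriod Φ₁ Φ₂)).map Matrix.SpecialLinearGroup.toGL) →ₗ⁅ℂ⁆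
      lieSubalgebraGL ((hodgeGroupC Φ₁).map Matrix.SpecialLinearGroup.toGL))
    (g : lieSubalgebraGL ((hodgeGroupC (prodPeriod Φ₁ Φ₂)).map Matrix.SpecialLinearGroup.toGL) →ₗ⁅ℂ⁆
      lieSubalgebraGL ((hodgeGroupC Φ₂).map Matrix.SpecialLinearGroup.toGL))
    (hf : ∀ Z, ((f Z : lieSubalgebraGL ((hodgeGroupC Φ₁).map Matrix.SpecialLinearGroup.toGL)) : Matrix ι₁ ι₁ ℂ) =
      (Z : Matrix (ι₁ ⊕ ι₂) (ι₁ ⊕ ι₂) ℂ).toBlocks₁₁)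
    (hg : ∀ Z, ((g Z : lieSubalgebraGL ((hodgeGroupC Φ₂).map Matrix.SpecialLinearGroup.toGL)) : Matrix ι₂ ι₂ ℂ) =
      (Z : Matrix (ι₁ ⊕ ι₂) (ι₁ ⊕ ι₂) ℂ).toBlocks₂₂)
    (hfs : Function.Surjective f) (hgs : Function.Surjective g) :
    (∀ W : lieSubalgebraGL ((hodgeGroupC Φ₁).map Matrix.SpecialLinearGroup.toGL),
        W ∈ LieIdeal.map f g.ker ↔ (W : Matrix ι₁ ι₁ ℂ) ∈ lieAlgebraGL ((hodgeGroupCProdInl Φ₁ Φ₂).map Matrix.SpecialLinearGroup.toGL)) ∧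
    (∀ W : lieSubalgebraGL ((hodgeGroupC Φ₂).map Matrix.SpecialLinearGroup.toGL),
        W ∈ LieIdeal.map g f.ker ↔ (W : Matrix ι₂ ι₂ ℂ) ∈ lieAlgebraGL ((hodgeGroupCProdInr Φ₁ Φ₂).map Matrix.SpecialLinearGroup.toGL)) := by
  constructor
  · intro W
    rw [GoursatLemma.mem_map_ker_iff f g hfs, mem_lieAlgebraGL_hodgeGroupCProdInl_iff_exists]
    constructor
    · rintro ⟨Z, hgZ, hfZ⟩
      refine ⟨(Z : Matrix (ι₁ ⊕ ι₂) (ι₁ ⊕ ι₂) ℂ), Z.2, ?_, ?_⟩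
      · have h := congrArg Subtype.val hgZ
        rw [hg Z] at h
        simpa using h
      · have h := congrArg Subtype.val hfZ
        rw [hf Z] at h
        exact h
    · rintro ⟨Z, hZ, h0, hW⟩
      refine ⟨⟨Z, hZ⟩, Subtype.ext ?_, Subtype.ext ?_⟩
      · rw [hg]
        simpa using h0
      · rw [hf]
        exact hW
  · intro W
    rw [GoursatLemma.mem_map_ker_iff g f hgs, mem_lieAlgebraGL_hodgeGroupCProdInr_iff_exists]
    constructor
    · rintro ⟨Z, hfZ, hgZ⟩
      refine ⟨(Z : Matrix (ι₁ ⊕ ι₂) (ι₁ ⊕ ι₂) ℂ), Z.2, ?_, ?_⟩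
      · have h := congrArg Subtype.val hfZ
        rw [hf Z] at h
        simpa using h
      · have h := congrArg Subtype.val hgZ
        rw [hg Z] at h
        exact h
    · rintro ⟨Z, hZ, h0, hW⟩
      refine ⟨⟨Z, hZ⟩, Subtype.ext ?_, Subtype.ext ?_⟩
      · rw [hf]
        simpa using h0
      · rw [hg]
        exact hW

/-- **MOONEN–ZARHIN (3.1) FOR TORI WITH REDUCTIVE `Lie Hg(Xᵢ)(ℂ)`, AS DISPLAYED**: there are ideals `N₁ ⊆ Lie Hg(X₁)(ℂ)`,
`N₂ ⊆ Lie Hg(X₂)(ℂ)` with carriers `Lie K₁`, `Lie K₂` (`𝔤₁`, `𝔤₂`) such that, with `𝔤₃ = Lie Hg(X₁)(ℂ) ⧸ N₁`: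
`Lie Hg(X₁ × X₂)(ℂ) ≅ N₁ × N₂ × 𝔤₃`, `Lie Hg(X₁)(ℂ) ≅ N₁ × 𝔤₃`, `Lie Hg(X₂)(ℂ) ≅ N₂ × 𝔤₃`, `𝔤₃ ≅ Lie Hg(X₂)(ℂ) ⧸ N₂`, and
`dim N₁ = dim K₁°`, `dim N₂ = dim K₂°`, `dim 𝔤₃ + dim K₁° = dim Hg(X₁)`, `dim Hg(X₁ × X₂) = dim K₁° + dim K₂° + dim 𝔤₃`.
[cite: MoonenZarhin1999LowDim, §3 (3.1) (p0006 L25–L45)] [cite: Gordon1997, §2.16 Proposition]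
[cite: Bourbaki1989LieGroups13, Ch. I §6 no. 4 Cor. (b) of Prop. 5] [cite: Springer1998, 4.4.5–4.4.7] -/
theorem exists_lieIdeal_carrier_lieEquiv_prod_prod_quotient
    [LieAlgebra.HasCentralRadical ℂ (lieSubalgebraGL ((hodgeGroupC Φ₁).map Matrix.SpecialLinearGroup.toGL))]
    [LieAlgebra.HasCentralRadical ℂ (lieSubalgebraGL ((hodgeGroupC Φ₂).map Matrix.SpecialLinearGroup.toGL))] :
    ∃ (N₁ : LieIdeal ℂ (lieSubalgebraGL ((hodgeGroupC Φ₁).map Matrix.SpecialLinearGroup.toGL)))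
      (N₂ : LieIdeal ℂ (lieSubalgebraGL ((hodgeGroupC Φ₂).map Matrix.SpecialLinearGroup.toGL))),
      (∀ W : lieSubalgebraGL ((hodgeGroupC Φ₁).map Matrix.SpecialLinearGroup.toGL),
        W ∈ N₁ ↔ (W : Matrix ι₁ ι₁ ℂ) ∈ lieAlgebraGL ((hodgeGroupCProdInl Φ₁ Φ₂).map Matrix.SpecialLinearGroup.toGL)) ∧
      (∀ W : lieSubalgebraGL ((hodgeGroupC Φ₂).map Matrix.SpecialLinearGroup.toGL),
        W ∈ N₂ ↔ (W : Matrix ι₂ ι₂ ℂ) ∈ lieAlgebraGL ((hodgeGroupCProdInr Φ₁ Φ₂).map Matrix.SpecialLinearGroup.toGL)) ∧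
      Nonempty (lieSubalgebraGL ((hodgeGroupC (prodPeriod Φ₁ Φ₂)).map Matrix.SpecialLinearGroup.toGL) ≃ₗ⁅ℂ⁆
        (N₁ × N₂ × (lieSubalgebraGL ((hodgeGroupC Φ₁).map Matrix.SpecialLinearGroup.toGL) ⧸ N₁))) ∧
      Nonempty (lieSubalgebraGL ((hodgeGroupC Φ₁).map Matrix.SpecialLinearGroup.toGL) ≃ₗ⁅ℂ⁆
        (N₁ × (lieSubalgebraGL ((hodgeGroupC Φ₁).map Matrix.SpecialLinearGroup.toGL) ⧸ N₁))) ∧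
      Nonempty (lieSubalgebraGL ((hodgeGroupC Φ₂).map Matrix.SpecialLinearGroup.toGL) ≃ₗ⁅ℂ⁆
        (N₂ × (lieSubalgebraGL ((hodgeGroupC Φ₁).map Matrix.SpecialLinearGroup.toGL) ⧸ N₁))) ∧
      Nonempty ((lieSubalgebraGL ((hodgeGroupC Φ₁).map Matrix.SpecialLinearGroup.toGL) ⧸ N₁) ≃ₗ⁅ℂ⁆
        (lieSubalgebraGL ((hodgeGroupC Φ₂).map Matrix.SpecialLinearGroup.toGL) ⧸ N₂)) ∧
      Module.finrank ℂ N₁ = (isZConnected_identityComponent (isAlgebraicSubgroup_map_toGL_hodgeGroupCProdInl Φ₁ Φ₂)).zdim ∧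
      Module.finrank ℂ N₂ = (isZConnected_identityComponent (isAlgebraicSubgroup_map_toGL_hodgeGroupCProdInr Φ₁ Φ₂)).zdim ∧
      Module.finrank ℂ (lieSubalgebraGL ((hodgeGroupC Φ₁).map Matrix.SpecialLinearGroup.toGL) ⧸ N₁) +
          (isZConnected_identityComponent (isAlgebraicSubgroup_map_toGL_hodgeGroupCProdInl Φ₁ Φ₂)).zdim =
        (isZConnected_map_toGL_hodgeGroupC Φ₁).zdim ∧
      (isZConnected_map_toGL_hodgeGroupC (prodPeriod Φ₁ Φ₂)).zdim =
        (isZConnected_identityComponent (isAlgebraicSubgroup_map_toGL_hodgeGroupCProdInl Φ₁ Φ₂)).zdim +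
          (isZConnected_identityComponent (isAlgebraicSubgroup_map_toGL_hodgeGroupCProdInr Φ₁ Φ₂)).zdim +
          Module.finrank ℂ (lieSubalgebraGL ((hodgeGroupC Φ₁).map Matrix.SpecialLinearGroup.toGL) ⧸ N₁) := by
  have hGc := isZConnected_map_toGL_hodgeGroupC (prodPeriod Φ₁ Φ₂)
  have hG₁c := isZConnected_map_toGL_hodgeGroupC Φ₁
  have hG₂c := isZConnected_map_toGL_hodgeGroupC Φ₂
  haveI : Module.Finite ℂ (lieSubalgebraGL ((hodgeGroupC (prodPeriod Φ₁ Φ₂)).map Matrix.SpecialLinearGroup.toGL)) :=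
    hGc.finrank_lieAlgebraGL_eq.1
  haveI : Module.Finite ℂ (lieSubalgebraGL ((hodgeGroupC Φ₁).map Matrix.SpecialLinearGroup.toGL)) :=
    hG₁c.finrank_lieAlgebraGL_eq.1
  haveI : Module.Finite ℂ (lieSubalgebraGL ((hodgeGroupC Φ₂).map Matrix.SpecialLinearGroup.toGL)) :=
    hG₂c.finrank_lieAlgebraGL_eq.1
  obtain ⟨f, g, hf, hg, hfs, hgs, hker⟩ := exists_lieHom_toBlocks Φ₁ Φ₂
  obtain ⟨hN₁, hN₂⟩ := carriers_of_toBlocks Φ₁ Φ₂ f g hf hg hfs hgs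
  obtain ⟨h𝔤, h𝔞, h𝔟, h₃⟩ := GoursatReductive.nonempty_lieEquiv_prod_prod_quotient_and f g hfs hgs hker
  -- dimensions by counting (Goursat rank formula + g38-#3)
  have e₀ : Module.finrank ℂ (lieSubalgebraGL ((hodgeGroupC (prodPeriod Φ₁ Φ₂)).map Matrix.SpecialLinearGroup.toGL)) =
      hGc.zdim := hGc.finrank_lieAlgebraGL_eq.2
  have e₁ : Module.finrank ℂ (lieSubalgebraGL ((hodgeGroupC Φ₁).map Matrix.SpecialLinearGroup.toGL)) = hG₁c.zdim :=
    hG₁c.finrank_lieAlgebraGL_eq.2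
  have e₂ : Module.finrank ℂ (lieSubalgebraGL ((hodgeGroupC Φ₂).map Matrix.SpecialLinearGroup.toGL)) = hG₂c.zdim :=
    hG₂c.finrank_lieAlgebraGL_eq.2
  have h₁ := GoursatLemma.finrank_eq_finrank_map_ker_add f g hfs hgs hker
  have h₂ := GoursatLemma.finrank_eq_finrank_map_ker_add' f g hfs hgs hker
  have d₁ := zdim_map_toGL_hodgeGroupC_prod_eq_add_zdim_identityComponent_hodgeGroupCProdInl Φ₁ Φ₂
  have d₂ := zdim_map_toGL_hodgeGroupC_prod_eq_add_zdim_identityComponent_hodgeGroupCProdInr Φ₁ Φ₂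
  have hq : Module.finrank ℂ (lieSubalgebraGL ((hodgeGroupC Φ₁).map Matrix.SpecialLinearGroup.toGL) ⧸ LieIdeal.map f g.ker) +
      Module.finrank ℂ (LieIdeal.map f g.ker) =
        Module.finrank ℂ (lieSubalgebraGL ((hodgeGroupC Φ₁).map Matrix.SpecialLinearGroup.toGL)) :=
    (LieIdeal.map f g.ker).toSubmodule.finrank_quotient_add_finrank
  exact ⟨LieIdeal.map f g.ker, LieIdeal.map g f.ker, hN₁, hN₂, h𝔤, h𝔞, h𝔟, h₃, by omega, by omega, by omega, by omega⟩

/-- **POLARISED FORM with carriers**: `X₁`, `X₂` polarised ⟹ `𝔥𝔤_ℂ(X₁ × X₂) ≅ 𝔤₁ × 𝔤₂ × 𝔤₃`, `𝔥𝔤_ℂ(X₁) ≅ 𝔤₁ × 𝔤₃`,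
`𝔥𝔤_ℂ(X₂) ≅ 𝔤₂ × 𝔤₃` with `𝔤₁`, `𝔤₂` THE ideals with carriers `Lie K₁`, `Lie K₂` and `𝔤₃ = 𝔥𝔤_ℂ(X₁) ⧸ 𝔤₁ ≅ 𝔥𝔤_ℂ(X₂) ⧸ 𝔤₂`.
[cite: MoonenZarhin1999LowDim, §3 (3.1) (p0006 L25–L45)] [cite: Gordon1997, §2.16 Proposition] [cite: Bourbaki1989LieGroups13, Ch. I §6 no. 4 Cor. (b) of Prop. 5] -/
theorem IsRiemannForm.exists_lieIdeal_carrier_lieEquiv_hodgeGroupComplexLie_prod_prod_quotient {η₁ : E₁ [⋀^Fin 2]→L[ℝ] ℝ}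
    {η₂ : E₂ [⋀^Fin 2]→L[ℝ] ℝ} (hη₁ : IsRiemannForm Φ₁ η₁) (hη₂ : IsRiemannForm Φ₂ η₂) :
    ∃ (N₁ : LieIdeal ℂ (hodgeGroupComplexLie Φ₁)) (N₂ : LieIdeal ℂ (hodgeGroupComplexLie Φ₂)),
      (∀ W : hodgeGroupComplexLie Φ₁,
        W ∈ N₁ ↔ (W : Matrix ι₁ ι₁ ℂ) ∈ lieAlgebraGL ((hodgeGroupCProdInl Φ₁ Φ₂).map Matrix.SpecialLinearGroup.toGL)) ∧
      (∀ W : hodgeGroupComplexLie Φ₂,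
        W ∈ N₂ ↔ (W : Matrix ι₂ ι₂ ℂ) ∈ lieAlgebraGL ((hodgeGroupCProdInr Φ₁ Φ₂).map Matrix.SpecialLinearGroup.toGL)) ∧
      Nonempty (hodgeGroupComplexLie (prodPeriod Φ₁ Φ₂) ≃ₗ⁅ℂ⁆ (N₁ × N₂ × (hodgeGroupComplexLie Φ₁ ⧸ N₁))) ∧
      Nonempty (hodgeGroupComplexLie Φ₁ ≃ₗ⁅ℂ⁆ (N₁ × (hodgeGroupComplexLie Φ₁ ⧸ N₁))) ∧
      Nonempty (hodgeGroupComplexLie Φ₂ ≃ₗ⁅ℂ⁆ (N₂ × (hodgeGroupComplexLie Φ₁ ⧸ N₁))) ∧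
      Nonempty ((hodgeGroupComplexLie Φ₁ ⧸ N₁) ≃ₗ⁅ℂ⁆ (hodgeGroupComplexLie Φ₂ ⧸ N₂)) ∧
      Module.finrank ℂ N₁ = (isZConnected_identityComponent (isAlgebraicSubgroup_map_toGL_hodgeGroupCProdInl Φ₁ Φ₂)).zdim ∧
      Module.finrank ℂ N₂ = (isZConnected_identityComponent (isAlgebraicSubgroup_map_toGL_hodgeGroupCProdInr Φ₁ Φ₂)).zdim := by
  have h₁ := hη₁.hasCentralRadical_hodgeGroupComplexLie
  have h₂ := hη₂.hasCentralRadical_hodgeGroupComplexLie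
  rw [hodgeGroupComplexLie_eq_lieSubalgebraGL Φ₁] at h₁ ⊢
  rw [hodgeGroupComplexLie_eq_lieSubalgebraGL Φ₂] at h₂ ⊢
  rw [hodgeGroupComplexLie_eq_lieSubalgebraGL (prodPeriod Φ₁ Φ₂)]
  haveI := h₁
  haveI := h₂
  obtain ⟨N₁, N₂, hN₁, hN₂, h𝔤, h𝔞, h𝔟, h₃, d₁, d₂, -, -⟩ := exists_lieIdeal_carrier_lieEquiv_prod_prod_quotient Φ₁ Φ₂
  exact ⟨N₁, N₂, hN₁, hN₂, h𝔤, h𝔞, h𝔟, h₃, d₁, d₂⟩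

/-- Abelian-variety form with carriers. [cite: MoonenZarhin1999LowDim, §3 (3.1) (p0006 L25–L45)] [cite: Gordon1997, §2.16 Proposition] -/
theorem IsAbelianVariety.exists_lieIdeal_carrier_lieEquiv_hodgeGroupComplexLie_prod_prod_quotient (hX₁ : IsAbelianVariety Φ₁)
    (hX₂ : IsAbelianVariety Φ₂) :
    ∃ (N₁ : LieIdeal ℂ (hodgeGroupComplexLie Φ₁)) (N₂ : LieIdeal ℂ (hodgeGroupComplexLie Φ₂)),
      (∀ W : hodgeGroupComplexLie Φ₁,
        W ∈ N₁ ↔ (W : Matrix ι₁ ι₁ ℂ) ∈ lieAlgebraGL ((hodgeGroupCProdInl Φ₁ Φ₂).map Matrix.SpecialLinearGroup.toGL)) ∧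
      (∀ W : hodgeGroupComplexLie Φ₂,
        W ∈ N₂ ↔ (W : Matrix ι₂ ι₂ ℂ) ∈ lieAlgebraGL ((hodgeGroupCProdInr Φ₁ Φ₂).map Matrix.SpecialLinearGroup.toGL)) ∧
      Nonempty (hodgeGroupComplexLie (prodPeriod Φ₁ Φ₂) ≃ₗ⁅ℂ⁆ (N₁ × N₂ × (hodgeGroupComplexLie Φ₁ ⧸ N₁))) ∧
      Nonempty (hodgeGroupComplexLie Φ₁ ≃ₗ⁅ℂ⁆ (N₁ × (hodgeGroupComplexLie Φ₁ ⧸ N₁))) ∧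
      Nonempty (hodgeGroupComplexLie Φ₂ ≃ₗ⁅ℂ⁆ (N₂ × (hodgeGroupComplexLie Φ₁ ⧸ N₁))) ∧
      Nonempty ((hodgeGroupComplexLie Φ₁ ⧸ N₁) ≃ₗ⁅ℂ⁆ (hodgeGroupComplexLie Φ₂ ⧸ N₂)) := by
  obtain ⟨η₁, hη₁⟩ := hX₁
  obtain ⟨η₂, hη₂⟩ := hX₂
  obtain ⟨N₁, N₂, hN₁, hN₂, h𝔤, h𝔞, h𝔟, h₃, -, -⟩ :=
    hη₁.exists_lieIdeal_carrier_lieEquiv_hodgeGroupComplexLie_prod_prod_quotient Φ₁ Φ₂ hη₂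
  exact ⟨N₁, N₂, hN₁, hN₂, h𝔤, h𝔞, h𝔟, h₃⟩

/-! ### §2 The graph case: both kernels finite -/

/-- **`K₁` AND `K₂` FINITE ⟹ `Lie Hg(X₁)(ℂ) ≅ Lie Hg(X₂)(ℂ)`** (both block projections are isomorphisms: "`𝔥𝔤(X₁) ≅ 𝔤₃ ≅ 𝔥𝔤(X₂)`"
and `𝔥𝔤(X₁ × X₂) = Γ_φ` is a graph), arbitrary tori. [cite: MoonenZarhin1999LowDim, §3 (3.1) (p0006 L25–L45)]
[cite: Gordon1997, §2.16 Proposition (second bullet: "the graph of an isomorphism")] -/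
theorem nonempty_lieEquiv_of_finite_of_finite
    (h₁ : ((hodgeGroupCProdInl Φ₁ Φ₂ : Subgroup (SpecialLinearGroup ι₁ ℂ)) : Set (SpecialLinearGroup ι₁ ℂ)).Finite)
    (h₂ : ((hodgeGroupCProdInr Φ₁ Φ₂ : Subgroup (SpecialLinearGroup ι₂ ℂ)) : Set (SpecialLinearGroup ι₂ ℂ)).Finite) :
    Nonempty (lieSubalgebraGL ((hodgeGroupC Φ₁).map Matrix.SpecialLinearGroup.toGL) ≃ₗ⁅ℂ⁆
      lieSubalgebraGL ((hodgeGroupC Φ₂).map Matrix.SpecialLinearGroup.toGL)) := by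
  obtain ⟨e₂⟩ := (finite_hodgeGroupCProdInl_iff_nonempty_lieEquiv Φ₁ Φ₂).1 h₁
  obtain ⟨e₁⟩ := (finite_hodgeGroupCProdInr_iff_nonempty_lieEquiv Φ₁ Φ₂).1 h₂
  exact ⟨e₁.symm.trans e₂⟩

/-- Analytic form: `K₁`, `K₂` finite ⟹ `𝔥𝔤_ℂ(X₁) ≅ 𝔥𝔤_ℂ(X₂)`. [cite: MoonenZarhin1999LowDim, §3 (3.1) (p0006 L25–L45)] -/
theorem nonempty_lieEquiv_hodgeGroupComplexLie_of_finite_of_finite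
    (h₁ : ((hodgeGroupCProdInl Φ₁ Φ₂ : Subgroup (SpecialLinearGroup ι₁ ℂ)) : Set (SpecialLinearGroup ι₁ ℂ)).Finite)
    (h₂ : ((hodgeGroupCProdInr Φ₁ Φ₂ : Subgroup (SpecialLinearGroup ι₂ ℂ)) : Set (SpecialLinearGroup ι₂ ℂ)).Finite) :
    Nonempty (hodgeGroupComplexLie Φ₁ ≃ₗ⁅ℂ⁆ hodgeGroupComplexLie Φ₂) := by
  rw [hodgeGroupComplexLie_eq_lieSubalgebraGL Φ₁, hodgeGroupComplexLie_eq_lieSubalgebraGL Φ₂]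
  exact nonempty_lieEquiv_of_finite_of_finite Φ₁ Φ₂ h₁ h₂

/-! ### §3 One-dimensional factor, non-split: `Lie Hg(X₁ × X₂)(ℂ) ≅ Lie Hg(X₁)(ℂ)` -/

/-- **Non-split with `dim Hg(X₂) = 1 ⟹ Lie Hg(X₁ × X₂)(ℂ) ≅ Lie Hg(X₁)(ℂ)`** ("`𝔥𝔤(X) = 𝔤₁ ⊕ 𝔤₃ ≅ 𝔥𝔤(X₁)`": `K₂` is finite
and `r₁` is an isomorphism). [cite: MoonenZarhin1999LowDim, §3 Lemma (3.6), proof (p0007 L22–L28)] -/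
theorem nonempty_lieEquiv_of_ne_of_zdim_eq_one (h : (isZConnected_map_toGL_hodgeGroupC Φ₂).zdim = 1)
    (hne : hodgeGroupC (prodPeriod Φ₁ Φ₂) ≠ blockDiagProd (hodgeGroupC Φ₁) (hodgeGroupC Φ₂)) :
    Nonempty (lieSubalgebraGL ((hodgeGroupC (prodPeriod Φ₁ Φ₂)).map Matrix.SpecialLinearGroup.toGL) ≃ₗ⁅ℂ⁆
      lieSubalgebraGL ((hodgeGroupC Φ₁).map Matrix.SpecialLinearGroup.toGL)) :=
  (finite_hodgeGroupCProdInr_iff_nonempty_lieEquiv Φ₁ Φ₂).1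
    ((hodgeGroupC_prod_ne_blockDiagProd_iff_finite_hodgeGroupCProdInr_of_zdim_eq_one Φ₁ Φ₂ h).1 hne)

/-- Non-split with `dim Hg(X₂) = 1 ⟹ Lie Hg(X₂)(ℂ)` is a quotient of `Lie Hg(X₁)(ℂ)` ("`𝔥𝔤(X₂) ≅ 𝔤₃`").
[cite: MoonenZarhin1999LowDim, §3 Lemma (3.6), proof (p0007 L22–L28)] [cite: Gordon1997, §2.16 Proposition] -/
theorem exists_surjective_lieHom_of_ne_of_zdim_eq_one (h : (isZConnected_map_toGL_hodgeGroupC Φ₂).zdim = 1)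
    (hne : hodgeGroupC (prodPeriod Φ₁ Φ₂) ≠ blockDiagProd (hodgeGroupC Φ₁) (hodgeGroupC Φ₂)) :
    ∃ φ : lieSubalgebraGL ((hodgeGroupC Φ₁).map Matrix.SpecialLinearGroup.toGL) →ₗ⁅ℂ⁆
        lieSubalgebraGL ((hodgeGroupC Φ₂).map Matrix.SpecialLinearGroup.toGL), Function.Surjective φ :=
  exists_surjective_lieHom_of_finite_hodgeGroupCProdInr Φ₁ Φ₂
    ((hodgeGroupC_prod_ne_blockDiagProd_iff_finite_hodgeGroupCProdInr_of_zdim_eq_one Φ₁ Φ₂ h).1 hne)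

/-- Analytic form: non-split with `dim Hg(X₂) = 1 ⟹ 𝔥𝔤_ℂ(X₁ × X₂) ≅ 𝔥𝔤_ℂ(X₁)`. [cite: MoonenZarhin1999LowDim, §3 Lemma (3.6), proof (p0007 L22–L28)] -/
theorem nonempty_lieEquiv_hodgeGroupComplexLie_of_ne_of_zdim_eq_one (h : (isZConnected_map_toGL_hodgeGroupC Φ₂).zdim = 1)
    (hne : hodgeGroupC (prodPeriod Φ₁ Φ₂) ≠ blockDiagProd (hodgeGroupC Φ₁) (hodgeGroupC Φ₂)) :
    Nonempty (hodgeGroupComplexLie (prodPeriod Φ₁ Φ₂) ≃ₗ⁅ℂ⁆ hodgeGroupComplexLie Φ₁) := by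
  rw [hodgeGroupComplexLie_eq_lieSubalgebraGL (prodPeriod Φ₁ Φ₂), hodgeGroupComplexLie_eq_lieSubalgebraGL Φ₁]
  exact nonempty_lieEquiv_of_ne_of_zdim_eq_one Φ₁ Φ₂ h hne

end ComplexTorus

end Literature.Geometry.Kaehler
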